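import Literature.Analysis.Asymptotics.LaplaceMethodComplexPhase
import HarnessLib

/-!
# The Laplace method with a complex phase — measurable amplitudes

Topic `Literature/Analysis/Asymptotics`; companion of `LaplaceMethodComplexPhase.lean`
(`Literature.Analysis.Asymptotics.tendsto_sqrt_mul_integral_exp_phase_sub`). Everything here is
PROVED; no definitions, no named facts.

The only change is that the amplitudes `Q_n : ℝ → ℂ` are assumed *measurable* instead of
continuous: continuity was used in the original proof only to obtain measurability of the
integrands. This is the form needed when the integral runs over a half-line (amplitude multiplied
by an indicator), as for the Barnes integrals `∫_0^∞ R_n(c_n + iy) sinh(πy)/cosh³(πy) dy` of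
Zudilin's linear forms in odd zeta values (after the conjugate-symmetry reduction
`∫_ℝ = 2i Im ∫_0^∞`). The statement and proof are otherwise identical (split at the window
`|u − u₀| ≤ δ`, rescale `u = u₀ + v/√n`, dominated convergence, `∫ e^{−cv²} = (π/c)^{1/2}`);
de Bruijn, *Asymptotic Methods in Analysis*, Ch. 4; folklore.
-/

noncomputable section

open _root_.MeasureTheory _root_.Filter _root_.Set _root_.Complex
open scoped _root_.Topology _root_.Real

namespace Literature.Analysis.Asymptotics

/-- **Laplace method with a complex phase, normalised form, measurable amplitudes.** As
`Literature.Analysis.Asymptotics.tendsto_sqrt_mul_integral_exp_phase_sub`, but the amplitudes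
`Q_n` are only assumed measurable (so that integrals over a half-line, written with an indicator,
are covered). Let `P : ℝ → ℂ` be continuous with
`‖P u − P u₀ + c (u − u₀)²‖ ≤ M |u − u₀|³` on `|u − u₀| ≤ δ` (`Re c > 0`, `0 ≤ M`, `M δ ≤ Re c / 2`)
and `Re P u ≤ Re P u₀ − η` for `|u − u₀| ≥ δ` (`η > 0`). Let `Q_n : ℝ → ℂ` be measurable with
`‖Q_n u‖ ≤ W u`, where `W ≤ B` on the window, `W · e^{Re P − Re P u₀}` is integrable, and
`Q_n u → L` as `(n, u) → (∞, u₀)`. Then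
`√n ∫ e^{n (P u − P u₀)} Q_n(u) du → L (π / c)^{1/2}`. [folklore] -/
theorem tendsto_sqrt_mul_integral_exp_phase_sub_of_measurable {P : ℝ → ℂ} (hP : Continuous P) {u₀ : ℝ} {c : ℂ}
    (hc : 0 < c.re) {δ M η : ℝ} (hδ : 0 < δ) (hM : 0 ≤ M) (hMδ : M * δ ≤ c.re / 2) (hη : 0 < η)
    (hT : ∀ u, |u - u₀| ≤ δ → ‖P u - P u₀ + c * (u - u₀) ^ 2‖ ≤ M * |u - u₀| ^ 3)
    (hgap : ∀ u, δ ≤ |u - u₀| → (P u).re ≤ (P u₀).re - η)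
    {Q : ℕ → ℝ → ℂ} (hQ : ∀ n, Measurable (Q n)) {W : ℝ → ℝ} {B : ℝ}
    (hQW : ∀ n u, ‖Q n u‖ ≤ W u) (hWB : ∀ u, |u - u₀| ≤ δ → W u ≤ B)
    (hW : Integrable (fun u => W u * Real.exp ((P u).re - (P u₀).re)))
    {L : ℂ} (hL : Tendsto (fun p : ℕ × ℝ => Q p.1 p.2) (atTop ×ˢ 𝓝 u₀) (𝓝 L)) :
    Tendsto (fun n : ℕ => (Real.sqrt n : ℂ) * ∫ u, cexp (n * (P u - P u₀)) * Q n u) atTop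
      (𝓝 (L * (π / c) ^ (1 / 2 : ℂ))) := by
  -- notation
  set f : ℕ → ℝ → ℂ := fun n u => cexp (n * (P u - P u₀)) * Q n u with hf
  set A : Set ℝ := Icc (u₀ - δ) (u₀ + δ) with hA
  have hAmeas : MeasurableSet A := measurableSet_Icc
  have hmemA : ∀ {u}, u ∈ A ↔ |u - u₀| ≤ δ := fun {u} => by
    rw [hA, mem_Icc, abs_le]; constructor <;> intro h <;> constructor <;> linarith
  have hW0 : ∀ u, 0 ≤ W u := fun u => (norm_nonneg _).trans (hQW 0 u)
  have hB0 : 0 ≤ B := (hW0 u₀).trans (hWB u₀ (by simp [hδ.le]))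
  -- `Re (P u - P u₀) ≤ 0` everywhere
  have hre0 : ∀ u, (P u - P u₀).re ≤ 0 := by
    intro u
    rcases le_or_gt (|u - u₀|) δ with hu | hu
    · exact re_phase_sub_nonpos_of_window hc hM hMδ hT hu
    · have := hgap u hu.le; rw [sub_re]; linarith
  -- norm of the exponential factor
  have hnexp : ∀ (n : ℕ) (u : ℝ), ‖cexp (n * (P u - P u₀))‖ = Real.exp (n * (P u - P u₀).re) := by
    intro n u; rw [norm_exp]; congr 1; simp [mul_re]
  have hfmeas : ∀ n, Measurable (f n) := fun n => by
    have : Continuous fun u => cexp (n * (P u - P u₀)) := by fun_prop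
    exact this.measurable.mul (hQ n)
  -- domination of `f n` (for `n ≥ 1`) by the integrable weight
  have hdom : ∀ n : ℕ, 1 ≤ n → ∀ u, ‖f n u‖ ≤ W u * Real.exp ((P u).re - (P u₀).re) := by
    intro n hn u
    rw [hf]; dsimp only; rw [norm_mul, hnexp]
    have hexp : Real.exp (n * (P u - P u₀).re) ≤ Real.exp ((P u).re - (P u₀).re) := by
      rw [Real.exp_le_exp, sub_re]
      have h1 : (1 : ℝ) ≤ n := by exact_mod_cast hn
      have := hre0 u; rw [sub_re] at this; nlinarith
    have h0 : (0 : ℝ) ≤ Real.exp ((P u).re - (P u₀).re) := (Real.exp_pos _).le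
    calc Real.exp (n * (P u - P u₀).re) * ‖Q n u‖
        ≤ Real.exp ((P u).re - (P u₀).re) * W u := mul_le_mul hexp (hQW n u) (norm_nonneg _) h0
      _ = W u * Real.exp ((P u).re - (P u₀).re) := mul_comm _ _
  have hfint : ∀ n : ℕ, 1 ≤ n → Integrable (f n) := fun n hn =>
    Integrable.mono' hW (hfmeas n).aestronglyMeasurable (Eventually.of_forall (hdom n hn))
  -- Step 1: the outer part is `O(e^{-(n-1)η})`
  set K : ℝ := ∫ u, W u * Real.exp ((P u).re - (P u₀).re) with hK
  have hK0 : 0 ≤ K := integral_nonneg fun u => mul_nonneg (hW0 u) (Real.exp_pos _).le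
  have houter : ∀ n : ℕ, 1 ≤ n →
      ‖∫ u in Aᶜ, f n u‖ ≤ Real.exp (-((n : ℝ) - 1) * η) * K := by
    intro n hn
    have h1 : (1 : ℝ) ≤ n := by exact_mod_cast hn
    have hb : ∀ u ∈ Aᶜ, ‖f n u‖ ≤
        Real.exp (-((n : ℝ) - 1) * η) * (W u * Real.exp ((P u).re - (P u₀).re)) := by
      intro u hu
      have hu' : δ ≤ |u - u₀| := by
        by_contra h
        exact hu (hmemA.2 (le_of_lt (not_le.1 h)))
      have hg := hgap u hu'
      rw [hf]
      dsimp only; rw [norm_mul, hnexp]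
      have hQle := hQW n u
      have hexp : Real.exp (n * (P u - P u₀).re) ≤
          Real.exp (-((n : ℝ) - 1) * η) * Real.exp ((P u).re - (P u₀).re) := by
        rw [← Real.exp_add, Real.exp_le_exp, sub_re]; nlinarith
      have h0 : (0 : ℝ) ≤ Real.exp (-((n : ℝ) - 1) * η) * Real.exp ((P u).re - (P u₀).re) :=
        mul_nonneg (Real.exp_pos _).le (Real.exp_pos _).le
      calc Real.exp (n * (P u - P u₀).re) * ‖Q n u‖
          ≤ (Real.exp (-((n : ℝ) - 1) * η) * Real.exp ((P u).re - (P u₀).re)) * W u :=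
            mul_le_mul hexp hQle (norm_nonneg _) h0
        _ = _ := by ring
    have hgi : Integrable (fun u => Real.exp (-((n : ℝ) - 1) * η) *
        (W u * Real.exp ((P u).re - (P u₀).re))) := hW.const_mul _
    calc ‖∫ u in Aᶜ, f n u‖
        ≤ ∫ u in Aᶜ, ‖f n u‖ := norm_integral_le_integral_norm _
      _ ≤ ∫ u in Aᶜ, Real.exp (-((n : ℝ) - 1) * η) *
            (W u * Real.exp ((P u).re - (P u₀).re)) := by
          refine setIntegral_mono_on (hfint n hn).norm.integrableOn hgi.integrableOn
            hAmeas.compl hb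
      _ ≤ ∫ u, Real.exp (-((n : ℝ) - 1) * η) *
            (W u * Real.exp ((P u).re - (P u₀).re)) :=
          setIntegral_le_integral hgi (Eventually.of_forall fun u =>
            mul_nonneg (Real.exp_pos _).le (mul_nonneg (hW0 u) (Real.exp_pos _).le))
      _ = Real.exp (-((n : ℝ) - 1) * η) * K := by rw [integral_const_mul]
  have houter0 : Tendsto (fun n : ℕ => (Real.sqrt n : ℂ) * ∫ u in Aᶜ, f n u) atTop (𝓝 0) := by
    rw [tendsto_zero_iff_norm_tendsto_zero]
    have hlim : Tendsto (fun n : ℕ => Real.sqrt n * Real.exp (-((n : ℝ) - 1) * η) * K)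
        atTop (𝓝 0) := by
      simpa using (tendsto_sqrt_mul_exp_neg η hη).mul_const K
    refine squeeze_zero_norm' ?_ hlim
    filter_upwards [eventually_ge_atTop 1] with n hn
    rw [norm_norm, norm_mul, Complex.norm_real, Real.norm_eq_abs,
      abs_of_nonneg (Real.sqrt_nonneg _), mul_assoc]
    exact mul_le_mul_of_nonneg_left (houter n hn) (Real.sqrt_nonneg _)
  -- Step 2: rescaling the inner part, `u = u₀ + v / √n`
  set s : ℕ → ℝ := fun n => Real.sqrt n with hs
  have hs0 : ∀ n : ℕ, 1 ≤ n → 0 < s n := fun n hn => by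
    rw [hs]; exact Real.sqrt_pos.2 (by exact_mod_cast hn)
  have hs2 : ∀ n : ℕ, s n ^ 2 = n := fun n => by
    rw [hs]; exact Real.sq_sqrt (Nat.cast_nonneg n)
  -- the rescaled integrand
  set g : ℕ → ℝ → ℂ := fun n v => (A.indicator (f n)) (u₀ + v / s n) with hg
  have hinner : ∀ n : ℕ, 1 ≤ n → ∫ v, g n v = (s n : ℂ) * ∫ u in A, f n u := by
    intro n hn
    have hsn := hs0 n hn
    rw [hg]; dsimp only
    have h1 : (∫ v : ℝ, A.indicator (f n) (u₀ + v / s n)) =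
        |s n| • ∫ w : ℝ, A.indicator (f n) (u₀ + w) := by
      have := Measure.integral_comp_div (fun w : ℝ => A.indicator (f n) (u₀ + w)) (s n)
      simpa using this
    have h2 : (∫ w : ℝ, A.indicator (f n) (u₀ + w)) = ∫ u, A.indicator (f n) u := by
      simpa [add_comm] using integral_add_right_eq_self (A.indicator (f n)) u₀
    rw [h1, h2, integral_indicator hAmeas, abs_of_pos hsn, real_smul]
  -- Step 3: dominated convergence for the rescaled integrand
  set bound : ℝ → ℝ := fun v => B * Real.exp (-(c.re / 2) * v ^ 2) with hbound
  have hbound_int : Integrable bound :=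
    (integrable_exp_neg_mul_sq (by linarith : 0 < c.re / 2)).const_mul B
  have hg_meas : ∀ n, AEStronglyMeasurable (g n) := by
    intro n
    have hcomp : Continuous fun v : ℝ => u₀ + v / s n := by fun_prop
    have heq : (fun v => (A.indicator (f n)) (u₀ + v / s n)) =
        ((fun v : ℝ => u₀ + v / s n) ⁻¹' A).indicator ((f n) ∘ (fun v : ℝ => u₀ + v / s n)) := by
      ext v
      exact (Set.indicator_comp_right (fun v : ℝ => u₀ + v / s n)).symm
    change AEStronglyMeasurable (fun v => (A.indicator (f n)) (u₀ + v / s n)) volume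
    rw [heq]
    exact ((hfmeas n).comp hcomp.measurable).aestronglyMeasurable.indicator
      (hAmeas.preimage hcomp.measurable)
  have hg_bound : ∀ n : ℕ, 1 ≤ n → ∀ v, ‖g n v‖ ≤ bound v := by
    intro n hn v
    have hsn := hs0 n hn
    rw [hg, hbound]; dsimp only
    by_cases hv : u₀ + v / s n ∈ A
    · rw [indicator_of_mem hv, hf]; dsimp only
      have hu : |u₀ + v / s n - u₀| ≤ δ := hmemA.1 hv
      rw [norm_mul, hnexp]
      have hre := re_phase_sub_le hM hMδ hT hu
      have hsub : u₀ + v / s n - u₀ = v / s n := by ring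
      have hnv : (n : ℝ) * (u₀ + v / s n - u₀) ^ 2 = v ^ 2 := by
        rw [hsub, div_pow, ← hs2 n]; field_simp
      have hexp : Real.exp (n * (P (u₀ + v / s n) - P u₀).re) ≤
          Real.exp (-(c.re / 2) * v ^ 2) := by
        rw [Real.exp_le_exp]
        have hn0 : (0 : ℝ) ≤ n := Nat.cast_nonneg n
        calc (n : ℝ) * (P (u₀ + v / s n) - P u₀).re
            ≤ n * (-(c.re / 2) * (u₀ + v / s n - u₀) ^ 2) :=
              mul_le_mul_of_nonneg_left hre hn0
          _ = -(c.re / 2) * v ^ 2 := by rw [← hnv]; ring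
      have hQB : ‖Q n (u₀ + v / s n)‖ ≤ B := (hQW n _).trans (hWB _ hu)
      calc Real.exp (n * (P (u₀ + v / s n) - P u₀).re) * ‖Q n (u₀ + v / s n)‖
          ≤ Real.exp (-(c.re / 2) * v ^ 2) * B :=
            mul_le_mul hexp hQB (norm_nonneg _) (by positivity)
        _ = B * Real.exp (-(c.re / 2) * v ^ 2) := by ring
    · rw [indicator_of_notMem hv, norm_zero]
      positivity
  have hg_lim : ∀ v, Tendsto (fun n => g n v) atTop (𝓝 (cexp (-c * v ^ 2) * L)) := by
    intro v
    have hsinf : Tendsto s atTop atTop := Real.tendsto_sqrt_atTop.comp tendsto_natCast_atTop_atTop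
    have hu : Tendsto (fun n : ℕ => u₀ + v / s n) atTop (𝓝 u₀) := tendsto_add_div_sqrt u₀ v
    -- eventually the point is inside the window
    have hev : ∀ᶠ n : ℕ in atTop, u₀ + v / s n ∈ A ∧ 1 ≤ n := by
      have h1 : ∀ᶠ n : ℕ in atTop, |v| / δ ≤ s n := hsinf.eventually (eventually_ge_atTop _)
      filter_upwards [h1, eventually_ge_atTop 1] with n hn hn1
      refine ⟨hmemA.2 ?_, hn1⟩
      have hsn := hs0 n hn1
      rw [show u₀ + v / s n - u₀ = v / s n by ring, abs_div, abs_of_pos hsn, div_le_iff₀ hsn]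
      rwa [div_le_iff₀ hδ, mul_comm] at hn
    -- the exponent tends to `-c v²`
    have hphase : Tendsto (fun n : ℕ => (n : ℂ) * (P (u₀ + v / s n) - P u₀)) atTop
        (𝓝 (-c * v ^ 2)) := by
      -- write `n (P u - P u₀) = -c v² + n r_n` with `‖n r_n‖ ≤ M |v|³ / s n`
      have hr : ∀ᶠ n : ℕ in atTop, ‖(n : ℂ) * (P (u₀ + v / s n) - P u₀) - (-c * v ^ 2)‖ ≤
          M * |v| ^ 3 / s n := by
        filter_upwards [hev] with n hn
        obtain ⟨hnA, hn1⟩ := hn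
        have hsn := hs0 n hn1
        have hu' : |u₀ + v / s n - u₀| ≤ δ := hmemA.1 hnA
        have hT' := hT _ hu'
        have hsub : u₀ + v / s n - u₀ = v / s n := by ring
        rw [hsub] at hT'
        have hid : (n : ℂ) * (P (u₀ + v / s n) - P u₀) - (-c * v ^ 2) =
            (n : ℂ) * (P (u₀ + v / s n) - P u₀ + c * ((u₀ + v / s n : ℝ) - u₀) ^ 2) := by
          have hc2 : (n : ℂ) * (c * (((u₀ + v / s n : ℝ) : ℂ) - u₀) ^ 2) = c * v ^ 2 := by
            have : (((u₀ + v / s n : ℝ) : ℂ) - u₀) = ((v / s n : ℝ) : ℂ) := by push_cast; ring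
            rw [this]
            have hnv : ((n : ℝ) : ℂ) * (((v / s n : ℝ) : ℂ)) ^ 2 = (v : ℂ) ^ 2 := by
              have hsc : (s n : ℂ) ≠ 0 := by exact_mod_cast hsn.ne'
              rw [← ofReal_pow, ← ofReal_mul, div_pow, ← hs2 n]
              push_cast
              field_simp
            calc (n : ℂ) * (c * (((v / s n : ℝ) : ℂ)) ^ 2) = c * (((n : ℝ) : ℂ) * (((v / s n : ℝ) : ℂ)) ^ 2) := by
                  push_cast; ring
              _ = c * v ^ 2 := by rw [hnv]
          rw [mul_add, hc2]; ring
        rw [hid, norm_mul, Complex.norm_natCast]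
        have hn0 : (0 : ℝ) ≤ n := Nat.cast_nonneg n
        calc (n : ℝ) * ‖P (u₀ + v / s n) - P u₀ + c * (((u₀ + v / s n : ℝ) : ℂ) - u₀) ^ 2‖
            ≤ n * (M * |v / s n| ^ 3) := mul_le_mul_of_nonneg_left hT' hn0
          _ = M * |v| ^ 3 / s n := by
              rw [abs_div, abs_of_pos hsn, div_pow]
              have : (s n) ^ 3 = n * s n := by rw [pow_succ, hs2 n]
              rw [this]
              field_simp
      have hr0 : Tendsto (fun n : ℕ => M * |v| ^ 3 / s n) atTop (𝓝 0) := by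
        simpa [div_eq_mul_inv] using (hsinf.inv_tendsto_atTop).const_mul (M * |v| ^ 3)
      have := squeeze_zero_norm' hr hr0
      rw [tendsto_sub_nhds_zero_iff] at this
      exact this
    have hQlim : Tendsto (fun n : ℕ => Q n (u₀ + v / s n)) atTop (𝓝 L) := by
      have hpair : Tendsto (fun n : ℕ => ((n, u₀ + v / s n) : ℕ × ℝ)) atTop (atTop ×ˢ 𝓝 u₀) :=
        tendsto_id.prodMk hu
      exact hL.comp hpair
    have hlim2 : Tendsto (fun n : ℕ => cexp (n * (P (u₀ + v / s n) - P u₀)) * Q n (u₀ + v / s n))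
        atTop (𝓝 (cexp (-c * v ^ 2) * L)) :=
      ((continuous_exp.tendsto _).comp hphase).mul hQlim
    refine hlim2.congr' ?_
    filter_upwards [hev] with n hn
    rw [hg]
    dsimp only
    rw [indicator_of_mem hn.1]
  have hDCT : Tendsto (fun n => ∫ v, g n v) atTop (𝓝 (∫ v : ℝ, cexp (-c * v ^ 2) * L)) := by
    refine tendsto_integral_filter_of_dominated_convergence bound
      (Eventually.of_forall hg_meas) ?_ hbound_int (Eventually.of_forall hg_lim)
    filter_upwards [eventually_ge_atTop 1] with n hn
    exact Eventually.of_forall (hg_bound n hn)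
  have hgauss : (∫ v : ℝ, cexp (-c * v ^ 2) * L) = L * (π / c) ^ (1 / 2 : ℂ) := by
    rw [integral_mul_const, integral_gaussian_complex hc, mul_comm]
  -- Step 4: assemble
  have hsplit : ∀ n : ℕ, 1 ≤ n →
      (s n : ℂ) * ∫ u, f n u = (∫ v, g n v) + (s n : ℂ) * ∫ u in Aᶜ, f n u := by
    intro n hn
    rw [hinner n hn, ← mul_add, integral_add_compl hAmeas (hfint n hn)]
  have hsum := (hDCT.add houter0)
  rw [hgauss, add_zero] at hsum
  refine hsum.congr' ?_
  filter_upwards [eventually_ge_atTop 1] with n hn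
  rw [← hsplit n hn]

/-- **Laplace method with a complex phase, measurable amplitudes.** Under the hypotheses of
`tendsto_sqrt_mul_integral_exp_phase_sub_of_measurable`,
`√n · e^{−n P(u₀)} · ∫ e^{n P(u)} Q_n(u) du → L (π / c)^{1/2}`; that is,
`∫ e^{n P} Q_n = e^{n P(u₀)} n^{−1/2} (L (π/c)^{1/2} + o(1))` (de Bruijn, *Asymptotic Methods in
Analysis*, Ch. 4; the one-contour saddle-point lemma, §5.7). [folklore] -/
theorem tendsto_sqrt_mul_integral_exp_phase_of_measurable {P : ℝ → ℂ} (hP : Continuous P) {u₀ : ℝ} {c : ℂ}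
    (hc : 0 < c.re) {δ M η : ℝ} (hδ : 0 < δ) (hM : 0 ≤ M) (hMδ : M * δ ≤ c.re / 2) (hη : 0 < η)
    (hT : ∀ u, |u - u₀| ≤ δ → ‖P u - P u₀ + c * (u - u₀) ^ 2‖ ≤ M * |u - u₀| ^ 3)
    (hgap : ∀ u, δ ≤ |u - u₀| → (P u).re ≤ (P u₀).re - η)
    {Q : ℕ → ℝ → ℂ} (hQ : ∀ n, Measurable (Q n)) {W : ℝ → ℝ} {B : ℝ}
    (hQW : ∀ n u, ‖Q n u‖ ≤ W u) (hWB : ∀ u, |u - u₀| ≤ δ → W u ≤ B)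
    (hW : Integrable (fun u => W u * Real.exp ((P u).re - (P u₀).re)))
    {L : ℂ} (hL : Tendsto (fun p : ℕ × ℝ => Q p.1 p.2) (atTop ×ˢ 𝓝 u₀) (𝓝 L)) :
    Tendsto (fun n : ℕ => (Real.sqrt n : ℂ) * cexp (-(n * P u₀)) * ∫ u, cexp (n * P u) * Q n u)
      atTop (𝓝 (L * (π / c) ^ (1 / 2 : ℂ))) := by
  have h := tendsto_sqrt_mul_integral_exp_phase_sub_of_measurable hP hc hδ hM hMδ hη hT hgap hQ hQW
    hWB hW hL
  refine h.congr fun n => ?_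
  rw [mul_assoc, ← integral_const_mul (cexp (-(n * P u₀)))]
  congr 1
  refine integral_congr_ae (Eventually.of_forall fun u => ?_)
  simp only
  rw [← mul_assoc, ← Complex.exp_add]
  congr 2
  ring

end Literature.Analysis.Asymptotics
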